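import Summits.Ventures.Crystal3D.Theorems.StickyWulffConstantCoaxialWallLawIncoherentOffset
import HarnessLib

/-!
# Incoherent translation pairs, rigid fillings I: the LINE TOP of a rising slot line

HONEST FRAMING. Part of the venture `Summits/Ventures/Crystal3D` (cell `crystal3d-full`), helper
`--supports` the crux `CoaxialWallLaw` (stmt-Ventures-19481, `route-Ventures-StickyWulffConstant`),
REGISTERED line `WallLedgerF` (planner cf-p1), open stub `stub_coaxialTwoSlabAdhesion`.  Rung credit only;
F-C1 not moved.  Memo HOME/wall-19481-p2/F-TWOPLATE-g5.md §3.  The elementary walk used by the rigid class-(A)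
rung (`…IncoherentCount`, `…IncoherentRigid`): in a configuration of bounded height, the straight walk
`p, p + A u, p + 2·A u, …` along a rising slot from a ball `p` with `p + A u ∈ X` has a last consecutive member
`t = p + k·A u`, `k ≥ 1`, with `t + A u ∉ X` (`exists_lineTop`, by `Nat.findGreatest` under the height bound).

WHAT THIS IS NOT: anything about walls; F-C1 not moved.
-/

noncomputable section

namespace Summit.Ventures.Crystal3D.Theorems

open Summit.Ventures.Crystal3D Finset
open scoped InnerProductSpace

/-- Height of a point on a slot line: `(p + j • v) 2 = p 2 + j · v 2`. -/
theorem apply_two_add_real_smul (p v : EuclideanSpace ℝ (Fin 3)) (j : ℝ) : (p + j • v) 2 = p 2 + j * v 2 := by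
  rw [PiLp.add_apply, PiLp.smul_apply, smul_eq_mul]

open scoped Classical in
/-- **The LINE TOP.**  In a configuration of bounded height, the walk `p, p + A u, p + 2 A u, …` along a rising slot
from a ball `p ∈ X` with `p + A u ∈ X` has a last consecutive member `t = p + k A u` (`k ≥ 1`): all
`p + j A u ∈ X` for `j ≤ k` and `t + A u ∉ X`. -/
theorem exists_lineTop (X : Finset (EuclideanSpace ℝ (Fin 3))) {H : ℝ} (hH : ∀ x ∈ X, x 2 ≤ H)
    (A : EuclideanSpace ℝ (Fin 3) ≃ₗᵢ[ℝ] EuclideanSpace ℝ (Fin 3)) {u : EuclideanSpace ℝ (Fin 3)}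
    (hu : 0 < (A u) 2) {p : EuclideanSpace ℝ (Fin 3)} (hp : p ∈ X) (hp1 : p + A u ∈ X) :
    ∃ k : ℕ, 1 ≤ k ∧ (∀ j : ℕ, j ≤ k → p + (j : ℝ) • A u ∈ X) ∧ p + (k : ℝ) • A u + A u ∉ X := by
  set good : ℕ → Prop := fun k => ∀ j : ℕ, j ≤ k → p + (j : ℝ) • A u ∈ X with hgood
  -- a height bound on the walk
  obtain ⟨N, hN⟩ := exists_nat_gt ((H - p 2) / (A u) 2)
  have hNbig : H < p 2 + (N : ℝ) * (A u) 2 := by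
    rw [div_lt_iff₀ hu] at hN; linarith
  have hgood0 : good 0 := by
    intro j hj
    have : j = 0 := Nat.le_zero.1 hj
    rw [this, Nat.cast_zero, zero_smul, add_zero]; exact hp
  have hgood1 : good 1 := by
    intro j hj
    rcases Nat.le_one_iff_eq_zero_or_eq_one.1 hj with rfl | rfl
    · rw [Nat.cast_zero, zero_smul, add_zero]; exact hp
    · rw [Nat.cast_one, one_smul]; exact hp1
  have hnotN : ¬ good N := by
    intro hN'
    have hmem := hN' N le_rfl
    have := hH _ hmem
    rw [apply_two_add_real_smul] at this
    linarith
  have h1N : 1 ≤ N := by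
    by_contra h0
    push Not at h0
    have : N = 0 := by omega
    rw [this] at hnotN; exact hnotN hgood0
  set k := Nat.findGreatest good N with hk
  have hk_good : good k := Nat.findGreatest_spec (P := good) (Nat.zero_le N) hgood0
  have hk1 : 1 ≤ k := Nat.le_findGreatest h1N hgood1
  have hkN : k < N := by
    rcases (Nat.findGreatest_le N : k ≤ N).lt_or_eq with h' | h'
    · exact h'
    · exact absurd (h' ▸ hk_good) hnotN
  have hnot : ¬ good (k + 1) := Nat.findGreatest_is_greatest (Nat.lt_succ_self k) hkN
  refine ⟨k, hk1, hk_good, ?_⟩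
  intro hmem
  apply hnot
  intro j hj
  rcases Nat.lt_or_eq_of_le hj with hlt | rfl
  · exact hk_good j (Nat.lt_succ_iff.1 hlt)
  · rw [Nat.cast_succ, add_smul, one_smul, ← add_assoc]; exact hmem

end Summit.Ventures.Crystal3D.Theorems

end
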